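import Summits.CriticalPhenomena.Ising3DConformalLimit.Theorems.EnergyNotSigmaSquaredGapForcesFarMergingReduction

/-!
# Far merging WITHOUT quasi-multiplicativity: stub 4 asserts more than the crux needs
# (negative-side analysis of crux `GapForcesFarMerging`, item stmt-CriticalPhenomena-4468; standing
# disprover, generation 4 — family E)

The line `rp-unpinch-single-passage` closes the crux modulo one-passage quasi-multiplicativity
`QuasiMultiplicativeShape cc2 (criticalCorr 3 4)` (`gapForcesFarMerging_of_quasiMultiplicative`).
QUESTION (converse): is stub 4 also NECESSARY — does the crux's conclusion (far merging), together
with every other input of the line, force quasi-multiplicativity, at least softly?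

ANSWER: NO. Family E — the `θ`-deformed Wick family over the kernel `S₀(a,b) = 1/(1+‖b−a‖_∞)` with
  `θ_E = θ_{A′}` on the nearest-neighbour stratum `{sep ≤ 1}` and `θ_E = 1/2` (family B) off it —
has the 22-field soft package, GAP (`κ = 1`), the isosceles RP minors, the un-pinched envelope, the
single-pinch law, strict single-pinch positivity, AND far merging (with `c = 1/9` along the collinear
shape, and with `c = 1` along every thin shape `Th(a)·s`, `s ≥ 2`: `thinMerging_E`), and nevertheless
VIOLATES quasi-multiplicativity, even in the dyadic sub-exponential-defect form:
`𝒜_E(e₂; m) = 2q_m² → 0` (the pinched functional is family A′'s) while `𝒜_E(s e₂; m) = 1` for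
`2 ≤ s ≤ m` (`avoid_v_E`). Headline: `quasiMultiplicative_not_forced_by_farMerging`,
`lineInputs_with_farMerging_without_QM`.

READING. Uniform quasi-multiplicativity FROM BELOW (`𝒜(e₂;m) ≥ c·𝒜(e₂;s)·𝒜(se₂;m)`) can fail in
a world WITH far merging: its failure mode "the adjacent pinch decays faster than the opened passage
predicts" is what STRONG merging looks like, not what a Gaussian bulk looks like. So stub 4 is a
sufficiency device strictly stronger than the crux relative to the line; the statement the iteration
actually consumes is the CONDITIONAL one of `Negative/TransparentPassage.lean`
(`PinchedTransparencyShape`: quasi-multiplicativity only across octave blocks in which the opened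
strands do not merge), which family E satisfies (vacuously: its thin shapes merge at every scale,
`thinMerging_E`) and family A′ violates.

References: Aizenman 1982 (`U₄ = -2⟨σσ⟩⟨σσ⟩·P[merge]`) [AizenmanCMP1982]; Lawler 1991, ch. 3–5
[Lawler1991]; Fröhlich–Israel–Lieb–Simon 1978 [FILS1978].
-/

noncomputable section

namespace Summit.CriticalPhenomena.Ising3DConformalLimit.Theorems.GapForcesFarMerging.Negative

open Literature.Probability.LatticeModels
open Summit.CriticalPhenomena.Ising3DConformalLimit.Theses.EnergyNotSigmaSquared

/-! ## Family E: A′ on the nearest-neighbour stratum, B in the bulk -/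

/-- `θ_E = θ_{A′}` if `sep ≤ 1`, `1/2` otherwise. [folklore] -/
def θE (y : Fin 4 → Site 3) : ℝ := if sep y ≤ 1 then θA' y else 1 / 2

/-- Family E. [folklore] -/
def FE : (Fin 4 → Site 3) → ℝ := Fθ θE

/-- `θ_E` is admissible. [folklore] -/
theorem thetaHyp_E : ThetaHyp θE where
  nonneg y := by
    unfold θE
    split_ifs
    · exact θA'_nonneg y
    · norm_num
  le_one y := by
    unfold θE
    split_ifs
    · exact (θA'_le_θA y).trans (θA_le_one y)
    · norm_num
  swap01 y := by simp only [θE, sep_comp_perm, thetaHyp_A'.swap01]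
  swap12 y := by simp only [θE, sep_comp_perm, thetaHyp_A'.swap12]
  swap23 y := by simp only [θE, sep_comp_perm, thetaHyp_A'.swap23]
  transl y v := by simp only [θE, sep_transl, thetaHyp_A'.transl]
  coincide a x z := by
    unfold θE
    rw [if_pos (by rw [sep_coincide]; norm_num)]
    exact thetaHyp_A'.coincide a x z

/-- Family E has the soft package. [folklore] -/
theorem softPackage_E : SoftPackage S₀ T₀ FE := softPackage_Fθ_core thetaHyp_E not_summable_S₀_sq

/-- Family E has the package without the bubble field. [folklore] -/
theorem softPackageNoBubble_E : SoftPackageNoBubble S₀ T₀ FE :=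
  ((softPackage_iff_noBubble_and_bubble _ _ _).1 softPackage_E).1

/-- `E = A′` on the nearest-neighbour stratum. [folklore] -/
theorem FE_eq_FA'_of_sep_le_one {y : Fin 4 → Site 3} (hy : sep y ≤ 1) : FE y = FA' y := by
  simp only [FE, FA', Fθ, θE, if_pos hy]

/-- `E = B` off the nearest-neighbour stratum. [folklore] -/
theorem FE_eq_FB_of_two_le_sep {y : Fin 4 → Site 3} (hy : 2 ≤ sep y) : FE y = FB y := by
  have h1 : ¬ sep y ≤ 1 := by linarith
  have h2 : sep y ≠ 0 := by linarith
  simp only [FE, FB, Fθ, θE, θB, if_neg h1, if_neg h2]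

/-- Off the nearest-neighbour stratum `U₄^E = -Pmin`. [folklore] -/
theorem FE_sub_wick_of_two_le_sep {y : Fin 4 → Site 3} (hy : 2 ≤ sep y) :
    FE y - (S₀ (y 0) (y 1) * S₀ (y 2) (y 3) + S₀ (y 0) (y 2) * S₀ (y 1) (y 3)
      + S₀ (y 0) (y 3) * S₀ (y 1) (y 2)) = -pmin S₀ y := by
  have h1 : ¬ sep y ≤ 1 := by linarith
  rw [FE, Fθ_sub_wick, θE, if_neg h1]; ring

/-! ## Verdicts: every input of the line, and far merging -/

/-- **E satisfies the GAP shape** (it is A′ on the adjacent stratum). [folklore] -/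
theorem gapShape_E : GapShape S₀ T₀ FE :=
  gapShape_of_le_add gapShape_A' 0 fun x _ => by
    rw [FE_eq_FA'_of_sep_le_one (sep_adjacent_le_one x)]; simp

/-- **E has far merging** (it is B on every dilation `L ≥ 2` of an injective shape). [folklore] -/
theorem farMergingShape_E : FarMergingShape S₀ FE := by
  obtain ⟨c, hc, x, hx, h⟩ := farMergingShape_B
  refine ⟨c, hc, x, hx, fun L₀ => ?_⟩
  obtain ⟨L, hL, hineq⟩ := h (max L₀ 2)
  refine ⟨L, (le_max_left _ _).trans hL, ?_⟩
  have hL2 : (2 : ℝ) ≤ L := by exact_mod_cast (le_max_right _ _).trans hL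
  rw [FE_eq_FB_of_two_le_sep (hL2.trans (le_sep_smul hx L))]
  exact hineq

section evals
variable {m s : ℕ} (hm : 1 ≤ m)
include hm

/-- `θ_E = 1/2` at the opened configuration `v = (0, s e₂, up m, dn m)`, `2 ≤ s ≤ m`. [folklore] -/
theorem θE_v (hs : 2 ≤ s) (hsm : s ≤ m) : θE ![0, src s, up m, dn m] = 1 / 2 := by
  obtain ⟨-, -, -, -, hsep⟩ := evals_v hm (le_trans (by norm_num) hs) hsm
  have hs' : ¬ ((s : ℝ) ≤ 1) := by
    have : (2 : ℝ) ≤ s := by exact_mod_cast hs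
    linarith
  unfold θE; rw [hsep, if_neg hs']

/-- `T_E(s e₂; m) = q²` for `2 ≤ s ≤ m`. [folklore] -/
theorem TS_v_E (hs : 2 ≤ s) (hsm : s ≤ m) :
    FE ![0, src s, up m, dn m] - S₀ 0 (src s) * S₀ (up m) (dn m) = q m * q m := by
  have hs1 : 1 ≤ s := le_trans (by norm_num) hs
  obtain ⟨h1, h2, h3, hp, -⟩ := evals_v hm hs1 hsm
  have hP1 : S₀ 0 (src s) * S₀ (up m) (dn m) = P₁ S₀ ![0, src s, up m, dn m] := by simp [P₁]
  rw [hP1, FE, Fθ, wick, hp, θE_v hm hs hsm, h1, h2, h3]; ring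

/-- **`𝒜_E(s e₂; m) = 1`** for `2 ≤ s ≤ m`: the opened passage costs nothing. [folklore] -/
theorem avoid_v_E (hs : 2 ≤ s) (hsm : s ≤ m) : avoidS S₀ FE (src s) m = 1 := by
  unfold avoidS TS NparS pairCovS
  rw [TS_v_E hm hs hsm, Npar_v hm (le_trans (by norm_num) hs) hsm]
  have := q_pos m
  field_simp

/-- `T_E(e₂; m) = 2q⁴` (the pinched configuration lies on the nearest-neighbour stratum: A′). [folklore] -/
theorem TS_w_E : FE ![0, e₂, up m, dn m] - S₀ 0 e₂ * S₀ (up m) (dn m) = 2 * (q m * q m) ^ 2 := by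
  rw [FE_eq_FA'_of_sep_le_one (by rw [(evals_w hm).2.2.2.2])]; exact TS_w hm

/-- **`𝒜_E(e₂; m) = 2q_m²`** (as for A′). [folklore] -/
theorem avoid_w_E : avoidS S₀ FE e₂ m = 2 * (q m * q m) := by
  unfold avoidS TS NparS pairCovS
  rw [TS_w_E hm, Npar_w hm]
  have := q_pos m
  field_simp

/-- The GAP quantity of E at `2m e₁`: `2q⁴` (A′). [folklore] -/
theorem gapq_x_E : FE ![0, e₂, xR m, xR m + e₂] - S₀ 0 e₂ * S₀ (xR m) (xR m + e₂) = 2 * (q m * q m) ^ 2 := by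
  rw [FE_eq_FA'_of_sep_le_one (by rw [(evals_x hm).2.2.2.2])]; exact gapq_x hm

/-- `θ_E = 1/2` at the mirror configuration `u = (m e₂, -m e₂, up m, dn m)`. [folklore] -/
theorem θE_u : θE ![Pi.single 1 (m : ℤ), Pi.single 1 (-(m : ℤ)), up m, dn m] = 1 / 2 := by
  obtain ⟨-, -, -, -, hsep⟩ := evals_u hm
  have hm' : ¬ (2 * (m : ℝ) ≤ 1) := by have := one_le_m hm; linarith
  unfold θE; rw [hsep, if_neg hm']

/-- The un-pinched pair–pair factor of E: `q²`. [folklore] -/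
theorem pairpair_u_E :
    FE ![Pi.single 1 (m : ℤ), Pi.single 1 (-(m : ℤ)), up m, dn m] -
        S₀ (Pi.single 1 (m : ℤ)) (Pi.single 1 (-(m : ℤ))) * S₀ (up m) (dn m) = q m * q m := by
  obtain ⟨h1, h2, h3, hp, -⟩ := evals_u hm
  have hP1 : S₀ (Pi.single 1 (m : ℤ)) (Pi.single 1 (-(m : ℤ))) * S₀ (up m) (dn m) =
      P₁ S₀ ![Pi.single 1 (m : ℤ), Pi.single 1 (-(m : ℤ)), up m, dn m] := by simp [P₁]
  rw [hP1, FE, Fθ, wick, hp, θE_u hm, h1, h2, h3]; ring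

end evals

section verdicts

/-- **E satisfies the single-pinch law** (`κ' = 2`, as A′). [folklore] -/
theorem singlePinchLawShape_E : SinglePinchLawShape S₀ T₀ FE := by
  obtain ⟨κ', C, hκ', h⟩ := singlePinchLawShape_A'
  refine ⟨κ', C, hκ', fun m hm => ?_⟩
  show FE ![0, e₂, up m, dn m] - S₀ 0 e₂ * S₀ (up m) (dn m) ≤ C * (2 * (m : ℝ)) ^ (-κ') * T₀ (xR m) ^ 2
  rw [TS_w_E hm, ← TS_w hm]
  exact h m hm

/-- **E has a strictly positive single-pinch truncation.** [folklore] -/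
theorem singlePinchPositiveShape_E : SinglePinchPositiveShape S₀ FE := fun m hm => by
  show 0 < FE ![0, e₂, up m, dn m] - S₀ 0 e₂ * S₀ (up m) (dn m)
  rw [TS_w_E hm]; have := q_pos m; positivity

/-- **E satisfies the un-pinched envelope** `0 ≤ q² ≤ 2q²`. [folklore] -/
theorem unpinchedEnvelopeShape_E : UnpinchedEnvelopeShape S₀ T₀ FE := fun m hm => by
  show 0 ≤ FE ![Pi.single 1 (m : ℤ), Pi.single 1 (-(m : ℤ)), up m, dn m] -
      S₀ (Pi.single 1 (m : ℤ)) (Pi.single 1 (-(m : ℤ))) * S₀ (up m) (dn m) ∧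
    FE ![Pi.single 1 (m : ℤ), Pi.single 1 (-(m : ℤ)), up m, dn m] -
      S₀ (Pi.single 1 (m : ℤ)) (Pi.single 1 (-(m : ℤ))) * S₀ (up m) (dn m) ≤ 2 * T₀ (xR m) ^ 2
  rw [pairpair_u_E hm, T₀_xR hm]
  have hq0 := q_pos m
  constructor
  · positivity
  · nlinarith [mul_pos hq0 hq0]

/-- **E satisfies the isosceles RP minors**: `(2q⁴)² ≤ 2q⁴ · q²`, i.e. `2q² ≤ 1`. [folklore] -/
theorem rpUnpinchIsoShape_E : RPUnpinchIsoShape S₀ FE := fun m hm => by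
  show (FE ![0, e₂, up m, dn m] - S₀ 0 e₂ * S₀ (up m) (dn m)) ^ 2 ≤
    (FE ![0, e₂, xR m, xR m + e₂] - S₀ 0 e₂ * S₀ (xR m) (xR m + e₂)) *
      (FE ![Pi.single 1 (m : ℤ), Pi.single 1 (-(m : ℤ)), up m, dn m] -
        S₀ (Pi.single 1 (m : ℤ)) (Pi.single 1 (-(m : ℤ))) * S₀ (up m) (dn m))
  rw [TS_w_E hm, gapq_x_E hm, pairpair_u_E hm]
  set Q := q m * q m with hQ
  have hQ0 : 0 < Q := mul_pos (q_pos m) (q_pos m)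
  have hQ4 : Q ≤ 1 / 4 := by have := q_le_half hm; have := q_pos m; rw [hQ]; nlinarith
  nlinarith [pow_pos hQ0 3, pow_pos hQ0 4]

/-- **E violates one-passage quasi-multiplicativity**: `𝒜_E(e₂;m) = 2q_m² → 0` while
`𝒜_E(e₂;2)·𝒜_E(2e₂;m) = 2/25`. [folklore] -/
theorem not_quasiMultiplicativeShape_E : ¬ QuasiMultiplicativeShape S₀ FE := by
  rintro ⟨c, hc, h⟩
  obtain ⟨n, hn⟩ := exists_nat_gt (25 / c)
  have hn0 : (0 : ℝ) < n := lt_trans (by positivity) hn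
  set m : ℕ := max n 4 with hm_def
  have hm4 : 4 ≤ m := le_max_right _ _
  have hm1 : 1 ≤ m := le_trans (by norm_num) hm4
  have hnm : (n : ℝ) ≤ m := by exact_mod_cast le_max_left n 4
  have key := h 2 m (by norm_num) (by omega)
  rw [avoid_w_E (by norm_num), avoid_w_E hm1, avoid_v_E hm1 le_rfl (by omega)] at key
  have hq2 : q 2 = 1 / 5 := by rw [q]; norm_num
  rw [hq2] at key
  have hq0 := q_pos m
  have hqm : q m < c / 25 := by
    have h1 : q m ≤ (n : ℝ)⁻¹ := by
      rw [q]; exact inv_anti₀ hn0 (by linarith)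
    have h2 : (n : ℝ)⁻¹ < c / 25 := by
      rw [div_lt_iff₀ hc] at hn
      rw [inv_lt_iff_one_lt_mul₀ hn0]
      linarith
    exact lt_of_le_of_lt h1 h2
  have hq1 : q m ≤ 1 := (q_le_half hm1).trans (by norm_num)
  -- key : c * (2 * (1/5 * (1/5))) * 1 ≤ 2 * (q m * q m)
  nlinarith [mul_pos hc hq0]

/-- **E violates even DYADIC quasi-multiplicativity with sub-exponential defect**: along
`(2^i, 2^{i+ℓ})` the required constant is `c(ℓ) ≤ (q_{2^{i+ℓ}}/q_{2^i})² < 4^{-ℓ}`, below `(3/4)^ℓ`. [folklore] -/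
theorem not_quasiMultiplicativeDyadicShape_E : ¬ QuasiMultiplicativeDyadicShape S₀ FE := by
  intro h
  obtain ⟨ℓ₀, hℓ₀⟩ := h (3 / 4) (by norm_num) (by norm_num)
  set ℓ : ℕ := max ℓ₀ 1 with hℓ_def
  have hℓ1 : 1 ≤ ℓ := le_max_right _ _
  obtain ⟨c, hc, i₁, hi⟩ := hℓ₀ ℓ (le_max_left _ _)
  set i : ℕ := max i₁ 1 with hi_def
  have key := hi i (le_max_left _ _)
  -- the scales s = 2^i ≥ 2 and m = 2^(i+ℓ) = 2^ℓ s ≥ 2 s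
  have hs2 : 2 ≤ 2 ^ i :=
    calc 2 = 2 ^ 1 := (pow_one 2).symm
      _ ≤ 2 ^ i := Nat.pow_le_pow_right (by norm_num) (le_max_right _ _)
  have hM2 : 2 ≤ 2 ^ ℓ :=
    calc 2 = 2 ^ 1 := (pow_one 2).symm
      _ ≤ 2 ^ ℓ := Nat.pow_le_pow_right (by norm_num) hℓ1
  have hsm : 2 ^ i ≤ 2 ^ (i + ℓ) := Nat.pow_le_pow_right (by norm_num) (by omega)
  have hm1 : 1 ≤ 2 ^ (i + ℓ) := Nat.one_le_two_pow
  have hs1 : 1 ≤ 2 ^ i := Nat.one_le_two_pow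
  rw [avoid_w_E hs1, avoid_w_E hm1, avoid_v_E hm1 hs2 hsm, mul_one] at key
  -- key : c * (2 * (q (2^i) * q (2^i))) ≤ 2 * (q (2^(i+ℓ)) * q (2^(i+ℓ)))
  set S : ℝ := ((2 ^ i : ℕ) : ℝ) with hS
  set M : ℝ := ((2 ^ ℓ : ℕ) : ℝ) with hM
  have hS2 : (2 : ℝ) ≤ S := by rw [hS]; exact_mod_cast hs2
  have hM2' : (2 : ℝ) ≤ M := by rw [hM]; exact_mod_cast hM2
  have hqs : q (2 ^ i) = (1 + 2 * S)⁻¹ := by rw [q]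
  have hqm : q (2 ^ (i + ℓ)) = (1 + 2 * (M * S))⁻¹ := by
    rw [q, hM, hS]; push_cast; rw [pow_add]; ring
  rw [hqs, hqm] at key
  -- (3/4)^ℓ ≤ c and 4^ℓ = M², 3^ℓ ≥ 3
  have h34 : (3 / 4 : ℝ) ^ ℓ * M ^ 2 = (3 : ℝ) ^ ℓ := by
    rw [hM]; push_cast
    rw [div_pow, ← pow_mul, show (4 : ℝ) = 2 ^ 2 by norm_num, ← pow_mul, mul_comm 2 ℓ]
    field_simp
  have h3 : (3 : ℝ) ≤ (3 : ℝ) ^ ℓ := by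
    calc (3 : ℝ) = 3 ^ 1 := (pow_one _).symm
      _ ≤ 3 ^ ℓ := pow_le_pow_right₀ (by norm_num) hℓ1
  have hcM : 3 ≤ c * M ^ 2 := by
    have := mul_le_mul_of_nonneg_right hc (sq_nonneg M)
    linarith
  -- from key: c (1 + 2 M S)² ≤ (1 + 2 S)²
  have hpos1 : 0 < 1 + 2 * S := by linarith
  have hpos2 : 0 < 1 + 2 * (M * S) := by nlinarith
  have key' : c * (1 + 2 * (M * S)) ^ 2 ≤ (1 + 2 * S) ^ 2 := by
    have e1 : (1 + 2 * S)⁻¹ * (1 + 2 * S)⁻¹ = ((1 + 2 * S) ^ 2)⁻¹ := by rw [sq, mul_inv]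
    have e2 : (1 + 2 * (M * S))⁻¹ * (1 + 2 * (M * S))⁻¹ = ((1 + 2 * (M * S)) ^ 2)⁻¹ := by
      rw [sq, mul_inv]
    rw [e1, e2] at key
    have hA : 0 < (1 + 2 * S) ^ 2 := by positivity
    have hB : 0 < (1 + 2 * (M * S)) ^ 2 := by positivity
    have k2 : c * ((1 + 2 * S) ^ 2)⁻¹ ≤ ((1 + 2 * (M * S)) ^ 2)⁻¹ := by linarith
    rw [← div_eq_mul_inv, div_le_iff₀ hA, ← div_eq_inv_mul] at k2
    rwa [le_div_iff₀ hB] at k2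
  -- c M² (2S)² ≤ c (1 + 2MS)² ≤ (1+2S)², with c M² ≥ 3 and S ≥ 2: contradiction
  have hc0 : 0 ≤ c := le_trans (by positivity) hc
  have h4 : c * (M ^ 2 * (2 * S) ^ 2) ≤ c * (1 + 2 * (M * S)) ^ 2 := by
    apply mul_le_mul_of_nonneg_left _ hc0
    nlinarith
  nlinarith

/-- **Far merging on every thin shape, at every scale**: for `2 ≤ s ≤ m`,
`U₄^E(0, dn m, s e₂, up m) = -⟨σ₀σ_{dn m}⟩⟨σ_{se₂}σ_{up m}⟩` (Aizenman's bound saturated in the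
parallel pairing: the opened strands of E merge with probability `1/2`… in the dictionary, `c = 1`). [folklore] -/
theorem thinMerging_E {s m : ℕ} (hm : 1 ≤ m) (hs : 2 ≤ s) (hsm : s ≤ m) :
    FE ![0, dn m, src s, up m] - (S₀ 0 (dn m) * S₀ (src s) (up m) + S₀ 0 (src s) * S₀ (dn m) (up m) +
        S₀ 0 (up m) * S₀ (dn m) (src s)) = -(S₀ 0 (dn m) * S₀ (src s) (up m)) := by
  have hs1 : 1 ≤ s := le_trans (by norm_num) hs
  obtain ⟨h1, h2, h3, hp, hsep⟩ := evals_v hm hs1 hsm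
  have hperm : FE ![0, dn m, src s, up m] = FE ![0, src s, up m, dn m] :=
    (Summit.CriticalPhenomena.Ising3DConformalLimit.EnergyNotSigmaSquaredGapForcesFarMerging.ScaleIteration.F_perm_dsu
      softPackageNoBubble_E (dn m) (src s) (up m)).symm
  have hP3 : S₀ 0 (dn m) * S₀ (src s) (up m) = P₃ S₀ ![0, src s, up m, dn m] := by simp [P₃]
  have hP1 : S₀ 0 (src s) * S₀ (dn m) (up m) = P₁ S₀ ![0, src s, up m, dn m] := by
    simp [P₁, S₀_symm (dn m) (up m)]
  have hP2 : S₀ 0 (up m) * S₀ (dn m) (src s) = P₂ S₀ ![0, src s, up m, dn m] := by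
    simp [P₂, S₀_symm (dn m) (src s)]
  rw [hperm, hP3, hP1, hP2, FE, Fθ, wick, hp, θE_v hm hs hsm, h1, h2, h3]; ring

/-- The witness, packaged: ALL soft inputs of the line AND far merging, without quasi-multiplicativity
(uniform or dyadic). [folklore] -/
theorem lineInputs_with_farMerging_without_QM :
    ∃ (S : Site 3 → Site 3 → ℝ) (T : Site 3 → ℝ) (F : (Fin 4 → Site 3) → ℝ),
      SoftPackage S T F ∧ GapShape S T F ∧ RPUnpinchIsoShape S F ∧ UnpinchedEnvelopeShape S T F ∧
        SinglePinchLawShape S T F ∧ SinglePinchPositiveShape S F ∧ FarMergingShape S F ∧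
        ¬ QuasiMultiplicativeShape S F ∧ ¬ QuasiMultiplicativeDyadicShape S F :=
  ⟨S₀, T₀, FE, softPackage_E, gapShape_E, rpUnpinchIsoShape_E, unpinchedEnvelopeShape_E,
    singlePinchLawShape_E, singlePinchPositiveShape_E, farMergingShape_E, not_quasiMultiplicativeShape_E,
    not_quasiMultiplicativeDyadicShape_E⟩

/-- **Quasi-multiplicativity is not forced by far merging** (stub 4 is not necessary, even softly and
even in its dyadic form): no argument from the soft package + GAP + isosceles RP + envelope +
single-pinch law + strict positivity + FAR MERGING proves dyadic quasi-multiplicativity. [folklore] -/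
theorem quasiMultiplicative_not_forced_by_farMerging :
    ¬ ∀ (S : Site 3 → Site 3 → ℝ) (T : Site 3 → ℝ) (F : (Fin 4 → Site 3) → ℝ),
      SoftPackage S T F → GapShape S T F → RPUnpinchIsoShape S F → UnpinchedEnvelopeShape S T F →
        SinglePinchLawShape S T F → SinglePinchPositiveShape S F → FarMergingShape S F →
          QuasiMultiplicativeDyadicShape S F :=
  fun h => not_quasiMultiplicativeDyadicShape_E (h S₀ T₀ FE softPackage_E gapShape_E rpUnpinchIsoShape_E
    unpinchedEnvelopeShape_E singlePinchLawShape_E singlePinchPositiveShape_E farMergingShape_E)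

end verdicts

end Summit.CriticalPhenomena.Ising3DConformalLimit.Theorems.GapForcesFarMerging.Negative

end
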